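import Summits.Ventures.DiscreteObjects.Hadamard.SqrtTwoNorm4q

/-!
# `4q` is not a sum of two squares in `ℚ(√3)` for a prime `q ≡ 11 (mod 12)` (norm obstruction for order-6 automorphisms)

Framing: lottery ticket; floor = certified bounds/negative ranges.

Cell pub-namedobj (venture DiscreteObjects), target (H), hadamard gen 14; number-theoretic input of the ORDER-6 analysis
(HANDOFF-H-g13 open item 3: an automorphism of order `6` of an `H(4q)` with fixed-point-free cube has an EVEN number of
`6`-cycles — the `√3`-folding).  With `ℚ(√3)` modelled as Mathlib's `QuadraticAlgebra ℚ 3 0` (pairs `re + im·ω`, `ω² = 3`),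
for a prime `q ≡ 11 (mod 12)` (`−3` is a non-residue since `q ≡ 2 (mod 3)`; `q ≡ 3 (mod 4)`):
* `neg_three_nonsquare_mod_q` — `z² ≠ −3` in `ZMod q` (a root would give a primitive cube root of unity `(z − 1)/2`, but
  `3 ∤ q − 1`);
* `even_padicValNat_sq_add_three_sq_q` — `v_q(s² + 3r²)` is even for `s² + 3r² > 0` (descent);
* `rat_norm_obstruction_4q_three` — no `a, b, c, d ∈ ℚ` with `ab + cd = 0`, `a² + c² + 3(b² + d²) = 4q`
  (otherwise `4q = (a² + c²)(1 + 3t²)` and `4q·(den² + 3·num²)` would be a sum of two squares with odd `q`-adic valuation);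
* `sqrtThree_irrational_fact` / `sqrtThree_field_fact` (`QuadraticAlgebra ℚ 3 0` is a field) and
  **`not_sum_two_sq_4q_sqrtThree`**: `¬ ∃ u v : QuadraticAlgebra ℚ 3 0, u² + v² = 4q`; instance `q = 167`:
  **`not_sum_two_sq_668_sqrtThree`** (and `716 = 4·179` is covered too: `179 ≡ 11 (mod 12)`).
Elementary (no quadratic reciprocity); ours; no `sorry`.
-/

namespace Summit.Ventures.DiscreteObjects.Hadamard

open Finset BigOperators

section normq3
variable {q : ℕ}

/-- `−3` is not a square modulo a prime `q ≡ 11 (mod 12)`: a square root `z` of `−3` would make `(z − 1)/2` a cube root of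
unity different from `1`, forcing `3 ∣ q − 1`. -/
theorem neg_three_nonsquare_mod_q (hq : q.Prime) (hq12 : q % 12 = 11) : ∀ z : ZMod q, z ^ 2 ≠ -3 := by
  haveI : Fact q.Prime := ⟨hq⟩
  intro z hz
  have h2 : (2 : ZMod q) ≠ 0 := by
    intro h
    have := (ZMod.natCast_eq_zero_iff 2 q).mp (by exact_mod_cast h)
    have := Nat.le_of_dvd (by norm_num) this
    omega
  have h3 : (3 : ZMod q) ≠ 0 := by
    intro h
    have := (ZMod.natCast_eq_zero_iff 3 q).mp (by exact_mod_cast h)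
    have := Nat.le_of_dvd (by norm_num) this
    omega
  set w : ZMod q := (z - 1) * (2 : ZMod q)⁻¹ with hw
  have hw2 : 2 * w = z - 1 := by
    rw [hw]; field_simp
  have hw3 : w ^ 3 = 1 := by
    have e1 : (2 : ZMod q) ^ 3 * (w ^ 3 - 1) = 0 := by
      have : (2 * w) ^ 3 - 8 = (z - 1) ^ 3 - 8 := by rw [hw2]
      linear_combination this + (z - 3) * hz
    rcases mul_eq_zero.mp e1 with h | h
    · exact absurd (pow_eq_zero_iff (n := 3) (by norm_num) |>.mp h) h2
    · exact sub_eq_zero.mp h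
  have hw1 : w ≠ 1 := by
    intro h1
    have e1 : z = 3 := by linear_combination -hw2 + 2 * h1
    rw [e1] at hz
    have : (3 : ZMod q) * 4 = 0 := by linear_combination hz
    rcases mul_eq_zero.mp this with h | h
    · exact h3 h
    · apply h2
      have : (2 : ZMod q) ^ 2 = 0 := by linear_combination h
      exact pow_eq_zero_iff (n := 2) (by norm_num) |>.mp this
  have hw0 : w ≠ 0 := by
    intro h0; rw [h0] at hw3; norm_num at hw3
  -- Fermat: w ^ (q - 1) = 1 with q - 1 = 3k + 1
  have hF := ZMod.pow_card_sub_one_eq_one hw0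
  have hk : q - 1 = 3 * ((q - 1) / 3) + 1 := by omega
  rw [hk, pow_add, pow_mul, hw3, one_pow, one_mul, pow_one] at hF
  exact hw1 hF

/-- **Descent**: `q ∣ s² + 3r²` forces `q ∣ s` and `q ∣ r` (`q ≡ 11 (mod 12)` prime). -/
theorem dvd_of_dvd_sq_add_three_sq_q (hq : q.Prime) (hq12 : q % 12 = 11) {s r : ℕ} (h : q ∣ s ^ 2 + 3 * r ^ 2) :
    q ∣ s ∧ q ∣ r := by
  haveI : Fact q.Prime := ⟨hq⟩
  have hz : ((s : ZMod q)) ^ 2 + 3 * ((r : ZMod q)) ^ 2 = 0 := by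
    have := (ZMod.natCast_eq_zero_iff (s ^ 2 + 3 * r ^ 2) q).mpr h
    push_cast at this
    exact this
  have hr : (r : ZMod q) = 0 := by
    by_contra hr
    have hsq : ((s : ZMod q) * (r : ZMod q)⁻¹) ^ 2 = -3 := by
      have hr2 : ((r : ZMod q)) ^ 2 ≠ 0 := pow_ne_zero _ hr
      field_simp
      linear_combination hz
    exact neg_three_nonsquare_mod_q hq hq12 _ hsq
  have hs : (s : ZMod q) = 0 := by
    rw [hr] at hz
    have : ((s : ZMod q)) ^ 2 = 0 := by linear_combination hz
    exact pow_eq_zero_iff (n := 2) (by norm_num) |>.mp this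
  exact ⟨(ZMod.natCast_eq_zero_iff s q).mp hs, (ZMod.natCast_eq_zero_iff r q).mp hr⟩

/-- **`v_q(s² + 3r²)` is even** for `s² + 3r² > 0` (`q ≡ 11 (mod 12)` prime). -/
theorem even_padicValNat_sq_add_three_sq_q (hq : q.Prime) (hq12 : q % 12 = 11) : ∀ K : ℕ, ∀ s r : ℕ,
    K = s ^ 2 + 3 * r ^ 2 → 0 < K → Even (padicValNat q K) := by
  haveI : Fact q.Prime := ⟨hq⟩
  have hq1 : 1 < q := hq.one_lt
  intro K
  induction K using Nat.strong_induction_on with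
  | _ K ih =>
    intro s r hK hpos
    by_cases hqK : q ∣ K
    · rw [hK] at hqK
      obtain ⟨⟨s', hs'⟩, ⟨r', hr'⟩⟩ := dvd_of_dvd_sq_add_three_sq_q hq hq12 hqK
      set K' := s' ^ 2 + 3 * r' ^ 2 with hK'
      have hKK' : K = q ^ 2 * K' := by rw [hK, hs', hr', hK']; ring
      have hK'pos : 0 < K' := by
        rcases Nat.eq_zero_or_pos K' with h0 | h0
        · rw [hKK', h0, mul_zero] at hpos; exact absurd hpos (lt_irrefl 0)
        · exact h0
      have hlt : K' < K := by
        rw [hKK']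
        have : 1 < q ^ 2 := by nlinarith
        nlinarith
      have hev := ih K' hlt s' r' hK' hK'pos
      rw [hKK', padicValNat.mul (pow_ne_zero _ hq.ne_zero) hK'pos.ne', padicValNat.prime_pow]
      exact (Nat.even_add.mpr (by simp [hev]))
    · rw [padicValNat.eq_zero_of_not_dvd hqK]
      exact Even.zero

/-- `padicValNat q (12q) = 1` for a prime `q ≥ 5` -/
theorem padicValNat_twelve_mul_self (hq : q.Prime) (hq5 : 5 ≤ q) : padicValNat q (12 * q) = 1 := by
  haveI : Fact q.Prime := ⟨hq⟩
  rw [padicValNat.mul (by norm_num) hq.ne_zero, padicValNat_self,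
    padicValNat.eq_zero_of_not_dvd (fun h12 => by
      have h223 : q ∣ 2 * 2 * 3 := by simpa using h12
      rcases (Nat.Prime.dvd_mul hq).mp h223 with h | h
      · rcases (Nat.Prime.dvd_mul hq).mp h with h' | h' <;>
          { have := Nat.le_of_dvd (by norm_num) h'; omega }
      · have := Nat.le_of_dvd (by norm_num) h; omega)]

/-- `12q` is not a sum of two natural squares for a prime `q ≡ 3 (mod 4)`, `q ≥ 5` -/
theorem not_sq_add_sq_twelve_mul_nat (hq : q.Prime) (hq4 : q % 4 = 3) (hq5 : 5 ≤ q) :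
    ¬ ∃ x y : ℕ, 12 * q = x ^ 2 + y ^ 2 := by
  haveI : Fact q.Prime := ⟨hq⟩
  intro h
  rw [Nat.eq_sq_add_sq_iff] at h
  have hmem : q ∈ (12 * q).primeFactors :=
    Nat.mem_primeFactors.mpr ⟨hq, dvd_mul_left q 12, Nat.mul_ne_zero (by norm_num) hq.ne_zero⟩
  have hev := h q hmem hq4
  rw [padicValNat_twelve_mul_self hq hq5] at hev
  exact Nat.not_even_one hev

/-- **Norm obstruction over `ℚ(√3)`**: for a prime `q ≡ 11 (mod 12)` there are no `a, b, c, d ∈ ℚ` with `ab + cd = 0` and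
`a² + c² + 3(b² + d²) = 4q` (i.e. `4q ≠ (a + b√3)² + (c + d√3)²`). -/
theorem rat_norm_obstruction_4q_three (hq : q.Prime) (hq12 : q % 12 = 11) :
    ¬ ∃ a b c d : ℚ, a * b + c * d = 0 ∧ a ^ 2 + c ^ 2 + 3 * (b ^ 2 + d ^ 2) = 4 * (q : ℚ) := by
  haveI : Fact q.Prime := ⟨hq⟩
  have hq4 : q % 4 = 3 := by omega
  have hq5 : 5 ≤ q := by omega
  rintro ⟨a, b, c, d, h1, h2⟩
  by_cases hac : a = 0 ∧ c = 0
  · obtain ⟨ha, hc⟩ := hac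
    have h2q : (3 * b) ^ 2 + (3 * d) ^ 2 = ((12 * q : ℕ) : ℚ) := by
      rw [ha, hc] at h2; push_cast; linear_combination 3 * h2
    exact not_sq_add_sq_twelve_mul_nat hq hq4 hq5 (nat_eq_sq_add_sq_of_rat h2q)
  · set m : ℚ := a ^ 2 + c ^ 2 with hm
    have hm0 : m ≠ 0 := by
      intro h0
      have ha : a = 0 := by nlinarith [sq_nonneg a, sq_nonneg c]
      have hc : c = 0 := by nlinarith [sq_nonneg a, sq_nonneg c]
      exact hac ⟨ha, hc⟩
    set t : ℚ := (a * d - b * c) / m with ht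
    have hb : b = -t * c := by
      have e1 : b * m = -c * (a * d - b * c) := by rw [hm]; linear_combination a * h1
      rw [ht]; field_simp; linear_combination e1
    have hd : d = t * a := by
      have e1 : d * m = a * (a * d - b * c) := by rw [hm]; linear_combination c * h1
      rw [ht]; field_simp; linear_combination e1
    have hkey : m * (1 + 3 * t ^ 2) = 4 * (q : ℚ) := by
      rw [hm]; rw [hb, hd] at h2; linear_combination h2
    set U : ℚ := a * (1 + 3 * t ^ 2) * t.den with hU
    set V : ℚ := c * (1 + 3 * t ^ 2) * t.den with hV
    set K : ℕ := t.den ^ 2 + 3 * t.num.natAbs ^ 2 with hK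
    have htnum : (t.num : ℚ) = t * t.den := by rw [Rat.mul_den_eq_num]
    have hnumsq : ((t.num.natAbs : ℕ) : ℚ) ^ 2 = (t.num : ℚ) ^ 2 := by
      rw [Nat.cast_natAbs, Int.cast_abs, sq_abs]
    have hkey' : (a ^ 2 + c ^ 2) * (1 + 3 * t ^ 2) = 4 * (q : ℚ) := by rw [← hm]; exact hkey
    have hUV : U ^ 2 + V ^ 2 = ((4 * q * K : ℕ) : ℚ) := by
      have eK : ((4 * q * K : ℕ) : ℚ) = 4 * (q : ℚ) * ((t.den : ℚ) ^ 2 + 3 * (t.num : ℚ) ^ 2) := by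
        rw [hK]; push_cast; rw [← hnumsq]
      rw [eK, htnum, hU, hV]
      linear_combination ((1 + 3 * t ^ 2) * (t.den : ℚ) ^ 2) * hkey'
    obtain ⟨x, y, hxy⟩ := nat_eq_sq_add_sq_of_rat hUV
    have hKpos : 0 < K := by
      have := t.den_pos
      rw [hK]; positivity
    have hsq : ∃ x y, 4 * q * K = x ^ 2 + y ^ 2 := ⟨x, y, hxy⟩
    rw [Nat.eq_sq_add_sq_iff] at hsq
    have h4q : 4 * q ≠ 0 := Nat.mul_ne_zero (by norm_num) hq.ne_zero
    have hmem : q ∈ (4 * q * K).primeFactors :=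
      Nat.mem_primeFactors.mpr ⟨hq, dvd_mul_of_dvd_left (dvd_mul_left q 4) _, Nat.mul_ne_zero h4q hKpos.ne'⟩
    have hev := hsq q hmem hq4
    rw [padicValNat.mul h4q hKpos.ne', padicValNat_four_mul_self hq (by omega)] at hev
    have hevK := even_padicValNat_sq_add_three_sq_q hq hq12 K t.den t.num.natAbs hK hKpos
    have : Even 1 := (Nat.even_add.mp hev).mpr hevK
    exact Nat.not_even_one this

/-- `√3 ∉ ℚ`: no rational `r` with `r² = 3 + 0·r` — the field condition for `QuadraticAlgebra ℚ 3 0 = ℚ(√3)`. -/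
theorem sqrtThree_irrational_fact : ∀ r : ℚ, r ^ 2 ≠ 3 + 0 * r := by
  intro r h
  rw [zero_mul, add_zero] at h
  have hR : ((r : ℝ)) ^ 2 = 3 := by exact_mod_cast h
  have hs : Real.sqrt 3 = |(r : ℝ)| := by
    rw [← hR, Real.sqrt_sq_eq_abs]
  have h3 : Irrational (Real.sqrt 3) := by
    simpa using Nat.prime_three.irrational_sqrt
  have : Real.sqrt 3 = ((|r| : ℚ) : ℝ) := by rw [hs]; push_cast; rfl
  exact h3.ne_rat |r| this

/-- `ℚ(√3)` as a field: the `Fact` that makes `QuadraticAlgebra ℚ 3 0` (`ω² = 3`) a field (use with `haveI`). -/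
theorem sqrtThree_field_fact : Fact (∀ r : ℚ, r ^ 2 ≠ 3 + 0 * r) := ⟨sqrtThree_irrational_fact⟩

/-- **`4q` is not a sum of two squares in `ℚ(√3)`** for a prime `q ≡ 11 (mod 12)`. -/
theorem not_sum_two_sq_4q_sqrtThree (hq : q.Prime) (hq12 : q % 12 = 11) :
    ¬ ∃ u v : QuadraticAlgebra ℚ 3 0, u ^ 2 + v ^ 2 = 4 * (q : QuadraticAlgebra ℚ 3 0) := by
  rintro ⟨u, v, h⟩
  have hre := congrArg QuadraticAlgebra.re h
  have him := congrArg QuadraticAlgebra.im h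
  simp only [sq, QuadraticAlgebra.re_add, QuadraticAlgebra.re_mul, QuadraticAlgebra.im_add, QuadraticAlgebra.im_mul,
    QuadraticAlgebra.re_ofNat, QuadraticAlgebra.im_ofNat, QuadraticAlgebra.re_natCast, QuadraticAlgebra.im_natCast]
    at hre him
  refine rat_norm_obstruction_4q_three hq hq12 ⟨u.re, u.im, v.re, v.im, ?_, ?_⟩
  · linear_combination him / 2
  · linear_combination hre

end normq3

/-- **`668` is not a sum of two squares in `ℚ(√3)`** (`q = 167 ≡ 11 (mod 12)`). -/
theorem not_sum_two_sq_668_sqrtThree : ¬ ∃ u v : QuadraticAlgebra ℚ 3 0, u ^ 2 + v ^ 2 = 668 := by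
  rintro ⟨u, v, h⟩
  refine not_sum_two_sq_4q_sqrtThree (q := 167) (by norm_num) (by norm_num) ⟨u, v, ?_⟩
  rw [h]; push_cast; norm_num

end Summit.Ventures.DiscreteObjects.Hadamard
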